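import Literature.NumberTheory.GaloisRepresentations.LocalArtinMapUnique
import Literature.NumberTheory.GaloisRepresentations.LocalArtinMapPinned
import Literature.NumberTheory.GaloisRepresentations.LocalReciprocityNormFunctorialityInsep
import HarnessLib

/-!
# Norm functoriality of THE local Artin maps (Serre XIII §4 Prop. 10, pinned form)

Let `E/F` be a finite extension of non-archimedean local fields (the valuation of `E` extending
that of `F`, `[ValuativeExtension F E]`; no separability assumption) and let
`h : res(W_E) ≤ W_F` be the inclusion of Weil groups under restriction `Γ_E → Γ_F` (supplied by
`WeilGroup.weilSubgroup_map_absGaloisRestrict_le`).  The tree pins the local Artin map of a local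
field by the five characterising clauses `IsLocalArtinMap` (`LocalClassFieldTheory.lean`: open
quotient map, kernel `closure [W, W]`, inertia onto units, geometric Frobenius `↦` uniformiser, and
the reciprocity law at finite level), and both halves of the pin are theorems:
existence (`exists_isLocalArtinMap_holds`, `LocalArtinMapPinned.lean`) and uniqueness
(`IsLocalArtinMap.unique_holds`, `LocalArtinMapUnique.lean`).  Norm functoriality was so far in
the tree only in EXISTENTIAL form (`exists_isCompatible_holds`: SOME pair of local Artin data of
`F` and `E` is norm-compatible).  This file proves it for THE maps:

* `IsLocalArtinMap.isCompatible`: if `dF.artin` and `dE.artin` both satisfy the five clauses, then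
  `dF.artin (res w) = N_{E/F} (dE.artin w)` for every `w ∈ W_E` (`LocalArtinData.IsCompatible`);
* `LocalArtinData.IsCanonical.isCompatible`: canonically normalised data (`d.artin = canonicalArtin`,
  the predicate imposed by the summit's `llc_isCanonical`) are norm-compatible;
* `canonicalArtin_isCompatible`, `canonicalArtin_map`: THE pinned maps `canonicalArtin F`,
  `canonicalArtin E` are norm-compatible, as data and pointwise.

## Proof

The finite-level norm-compatible reciprocity systems `ω^F`, `ω^E` exist unconditionally
(`LocalWeilDatum.exists_isReciprocitySystem_normCompatible_holds F E`, Neukirch's route, covering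
inseparable `E/F` through the relative Frobenius).  Their limits `θ_F`, `θ_E` are reciprocity maps
(`IsReciprocitySystem.isLocalReciprocityMap_theta`, fed with `universalNormSubgroup_eq_bot` and
`isClosed_of_isNormSubgroup_holds`) with `θ_F ∘ N_{E/F} = i ∘ θ_E`
(`IsReciprocitySystem.isNormCompatible_theta`), so their Artin maps `w ↦ (θ⁻¹[w])⁻¹` are
norm-compatible (`IsLocalReciprocityMap.isCompatible`) — this is the chain behind
`exists_isCompatible_of_isReciprocitySystem`, rerun with the data kept explicit.  Both Artin maps
satisfy the five clauses (`IsReciprocitySystem.isLocalArtinMap_artin`), hence by uniqueness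
(`IsLocalArtinMap.unique_holds`) they ARE `dF.artin`, `dE.artin`, and the compatibility equation
transports.

## References

* J.-P. Serre, *Local Fields*, GTM 67, Springer 1979, Ch. XIII §4, Prop. 10 and Thm. 1–2.
  [SerreLocalFields1979]
* J.-P. Serre, *Local class field theory*, Ch. VI of Cassels–Fröhlich (1967), §2.4.
  [CasselsFrohlichANT1967]
* J. Tate, *Number theoretic background* (Corvallis 1979), (1.4.1)–(1.4.6).  [Corvallis1979]
-/

noncomputable section

open ValuativeRel Field

namespace Literature.NumberTheory.GaloisRepresentations

universe u v

section NormCompatible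

variable {F : Type u} {E : Type v} [Field F] [ValuativeRel F] [TopologicalSpace F]
  [IsNonarchimedeanLocalField F] [Field E] [ValuativeRel E] [TopologicalSpace E]
  [IsNonarchimedeanLocalField E] [Algebra F E] [FiniteDimensional F E] [ValuativeExtension F E]

/-- **Norm functoriality of the local Artin maps** (Serre, *Local Fields*, XIII §4 Prop. 10, for
THE maps): for a finite extension `E/F` of non-archimedean local fields and local Artin data `dF`,
`dE` whose Artin maps satisfy the five characterising clauses `IsLocalArtinMap`, the square with
restriction `W_E → W_F` and the norm `N_{E/F} : Eˣ → Fˣ` commutes: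
`dF.artin (res w) = N_{E/F} (dE.artin w)` for all `w ∈ W_E`.  Proof: the Artin maps of the limits
`θ_F`, `θ_E` of a norm-compatible pair of finite-level reciprocity systems
(`LocalWeilDatum.exists_isReciprocitySystem_normCompatible_holds`, valid also for inseparable
`E/F`) are norm-compatible (`isNormCompatible_theta`, `IsLocalReciprocityMap.isCompatible`) and
satisfy the five clauses (`IsReciprocitySystem.isLocalArtinMap_artin`), so by uniqueness of the
local Artin map (`IsLocalArtinMap.unique_holds`) they are `dF.artin` and `dE.artin`.
[cite: SerreLocalFields1979, Ch. XIII §4 Prop. 10] -/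
theorem IsLocalArtinMap.isCompatible
    (h : (weilSubgroup E).map (absGaloisRestrict F E).toMonoidHom ≤ weilSubgroup F)
    {dF : LocalArtinData F} {dE : LocalArtinData E} (hF : IsLocalArtinMap F dF.artin)
    (hE : IsLocalArtinMap E dE.artin) : dF.IsCompatible dE h := by
  obtain ⟨ωF, ωE, hωF, hωE, hN⟩ :=
    LocalWeilDatum.exists_isReciprocitySystem_normCompatible_holds F E
  have hθF : IsLocalReciprocityMap F hωF.theta :=
    hωF.isLocalReciprocityMap_theta (universalNormSubgroup_eq_bot F)
      (isClosed_of_isNormSubgroup_holds F)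
  have hθE : IsLocalReciprocityMap E hωE.theta :=
    hωE.isLocalReciprocityMap_theta (universalNormSubgroup_eq_bot E)
      (isClosed_of_isNormSubgroup_holds E)
  have hcompat : (hθF.toLocalArtinData (WeilGroup.denseRange_toAbsGalois_holds F)).IsCompatible
      (hθE.toLocalArtinData (WeilGroup.denseRange_toAbsGalois_holds E)) h :=
    hθF.isCompatible hθE (hωF.isNormCompatible_theta hωE hN) _ _ h
  have eF : dF.artin = hθF.artin := IsLocalArtinMap.unique_holds F _ _ hF
    (hωF.isLocalArtinMap_artin hθF (WeilGroup.denseRange_toAbsGalois_holds F))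
  have eE : dE.artin = hθE.artin := IsLocalArtinMap.unique_holds E _ _ hE
    (hωE.isLocalArtinMap_artin hθE (WeilGroup.denseRange_toAbsGalois_holds E))
  intro w
  rw [eF, eE]
  exact hcompat w

/-- **Norm functoriality, pointwise on `F`**: under the hypotheses of
`IsLocalArtinMap.isCompatible`, `↑(dF.artin (res w)) = N_{E/F} ↑(dE.artin w)` in `F`
(`LocalArtinData.isCompatible_iff`). [cite: SerreLocalFields1979, Ch. XIII §4 Prop. 10] -/
theorem IsLocalArtinMap.coe_artin_map
    (h : (weilSubgroup E).map (absGaloisRestrict F E).toMonoidHom ≤ weilSubgroup F)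
    {dF : LocalArtinData F} {dE : LocalArtinData E} (hF : IsLocalArtinMap F dF.artin)
    (hE : IsLocalArtinMap E dE.artin) (w : WeilGroup E) :
    (dF.artin (WeilGroup.map F E h w) : F) = Algebra.norm F (dE.artin w : E) :=
  (dF.isCompatible_iff dE h).mp (hF.isCompatible h hE) w

/-- **Canonically normalised local Artin data are norm-compatible**: if `dF.artin = canonicalArtin F`
and `dE.artin = canonicalArtin E` (`LocalArtinData.IsCanonical`, the normalisation the summit
imposes on every `Rec.llc v`), then `dF.artin (res w) = N_{E/F} (dE.artin w)` on `W_E` — both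
pinned maps have the five clauses (`isLocalArtinMap_canonicalArtin_holds`), so
`IsLocalArtinMap.isCompatible` applies.  This is the form consumed by base change / ascent along
`K_v ⊆ L_w`. [cite: SerreLocalFields1979, Ch. XIII §4 Prop. 10] -/
theorem LocalArtinData.IsCanonical.isCompatible {dF : LocalArtinData F} {dE : LocalArtinData E}
    (hdF : dF.IsCanonical) (hdE : dE.IsCanonical)
    (h : (weilSubgroup E).map (absGaloisRestrict F E).toMonoidHom ≤ weilSubgroup F) :
    dF.IsCompatible dE h := by
  refine IsLocalArtinMap.isCompatible h ?_ ?_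
  · rw [show dF.artin = canonicalArtin F from hdF]
    exact isLocalArtinMap_canonicalArtin_holds F
  · rw [show dE.artin = canonicalArtin E from hdE]
    exact isLocalArtinMap_canonicalArtin_holds E

variable (F E) in
/-- **THE canonical local Artin data of `F` and `E` are norm-compatible**: the data
`LocalArtinData.ofExistsIsLocalArtinMap` packaging the pinned maps `canonicalArtin F`,
`canonicalArtin E` (with the clauses they satisfy by `exists_isLocalArtinMap_holds`) satisfy
`LocalArtinData.IsCompatible` along every finite `E/F`.
[cite: SerreLocalFields1979, Ch. XIII §4 Prop. 10] -/
theorem canonicalArtin_isCompatible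
    (h : (weilSubgroup E).map (absGaloisRestrict F E).toMonoidHom ≤ weilSubgroup F) :
    (LocalArtinData.ofExistsIsLocalArtinMap (exists_isLocalArtinMap_holds F)).IsCompatible
      (LocalArtinData.ofExistsIsLocalArtinMap (exists_isLocalArtinMap_holds E)) h :=
  (LocalArtinData.isCanonical_ofExistsIsLocalArtinMap (exists_isLocalArtinMap_holds F)).isCompatible
    (LocalArtinData.isCanonical_ofExistsIsLocalArtinMap (exists_isLocalArtinMap_holds E)) h

variable (F E) in
/-- **Norm functoriality of THE local Artin maps, pointwise**:
`canonicalArtin F (res w) = N_{E/F} (canonicalArtin E w)` in `Fˣ` for every `w ∈ W_E`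
(Serre, *Local Fields*, XIII §4 Prop. 10: `Art_F ∘ res = N_{E/F} ∘ Art_E`).
[cite: SerreLocalFields1979, Ch. XIII §4 Prop. 10] -/
theorem canonicalArtin_map
    (h : (weilSubgroup E).map (absGaloisRestrict F E).toMonoidHom ≤ weilSubgroup F)
    (w : WeilGroup E) :
    canonicalArtin F (WeilGroup.map F E h w) =
      Units.map (Algebra.norm F : E →* F) (canonicalArtin E w) :=
  canonicalArtin_isCompatible F E h w

variable (F E) in
/-- **Norm functoriality of THE local Artin maps, pointwise on `F`**:
`↑(canonicalArtin F (res w)) = N_{E/F} ↑(canonicalArtin E w)` in `F`.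
[cite: SerreLocalFields1979, Ch. XIII §4 Prop. 10] -/
theorem coe_canonicalArtin_map
    (h : (weilSubgroup E).map (absGaloisRestrict F E).toMonoidHom ≤ weilSubgroup F)
    (w : WeilGroup E) :
    (canonicalArtin F (WeilGroup.map F E h w) : F) = Algebra.norm F (canonicalArtin E w : E) := by
  have := congrArg Units.val (canonicalArtin_map F E h w)
  rwa [Units.coe_map] at this

end NormCompatible

end Literature.NumberTheory.GaloisRepresentations
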